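import Literature.Probability.Percolation.TwoAvoidanceSets
import Summits.CriticalPhenomena.PercolationContinuityZ3.Theorems.PercNearOneGluingNoHeavyLowerTailCoreAttraction
import Literature.Probability.Percolation.TwoClusterConditionalAssociationProofs
import HarnessLib

/-!
# `NoHeavyLowerTail` (stmt-CriticalPhenomena-4575) — core attraction given a separation

Support file (prover `prim-lf-1`, lemma factory #1; `--supports stmt-CriticalPhenomena-4575`).  No definitions,
no named facts, no sorries.  Companion of `…CoreAttraction.lean`.

Random-core ("floating sink") calculus: `μ = prodBernoulli w`, core `R` with anchor `c`, `Γ = ⋂_{r∈R} {c ↔ r}`,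
vertices `o, a, b`.  In the seat memo's 3×3 "o/core table" given `{a ↮ b} ∩ Γ` (CANDIDATES.md BATCH 8) the
theorem below is the minor `D(o: B<NA; R: B<FA)`:
  `μ(D ∩ Γ ∩ {b↔o} ∩ {b↮c}) · μ(D ∩ {b↮o} ∩ {R ⊆ C_b}) ≤ μ(D ∩ {b↔o} ∩ {R ⊆ C_b}) · μ(D ∩ Γ ∩ {b↮o} ∩ {b↮c})`,
`D = {b ↮ a}` — "given that `b` is separated from `a`, the observer `o` and the internally connected core are
positively dependent with respect to membership in `C_b`".  It is not an instance of the two-cluster calculus of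
van den Berg–Häggström–Kahn (the column "core free but connected" is of neither type); the proof replaces the two
Harris inequalities of `CoreAttraction.coreAttraction` by BHK's Theorem 1.3 (conditional positive association of
`C_b` given `{b ↮ a}`, tree fact `BHK2006_clusterConditionalPositiveAssociation_holds`), applied to
`f = 1{o ∈ C_b}` with the increasing `h = 1{R ⊆ C_b}` and with the DECREASING free-core weight
`ρ(C_b) = 1{c ∉ C_b} · P(Γ | C_b)`, plus the domain Markov property of `C_b` (`BHK2006.sum_cond_cluster`).
-/

noncomputable section

namespace Summit.CriticalPhenomena.PercolationContinuityZ3.Theorems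

open MeasureTheory Set Literature.Probability.LatticeModels Literature.Probability.Percolation
open BHK2006 DecisionTree TwoAvoidanceSets CoreAttraction
open scoped Classical BigOperators

namespace CoreAttractionSep

variable {V : Type*} [Fintype V]


/-! ### Core attraction given a separation `{b ↮ a}` (table minor `D(o: B < NA; R: B < FA)`, BATCH 8) -/

/-- `∫_D h dμ = Σ_ω weight(ω) h(ω) 1_D(ω)` on the finite configuration space. [folklore] -/
theorem setIntegral_eq_sum_ind (w : Sym2 V → unitInterval) (D : Set (Set (Sym2 V))) (h : Set (Sym2 V) → ℝ) :
    ∫ ω in D, h ω ∂(prodBernoulli w) = ∑ ω, weight (fun e => (w e : ℝ)) ω * (h ω * ind D ω) := by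
  rw [← integral_indicator MeasurableSet.of_discrete, integral_prodBernoulli_eq_sum]
  refine Finset.sum_congr rfl fun ω _ => ?_
  by_cases hω : ω ∈ D
  · rw [Set.indicator_of_mem hω, ind_of_mem hω, mul_one]
  · simp [Set.indicator_of_notMem hω, ind_of_not_mem hω]

/-- **Core attraction given `{b ↮ a}`** (random-core row "T2" = the table minor `D(o: B<NA; R: B<FA)` of the
seat memo CANDIDATES.md BATCH 8; not a BHK two-cluster instance).  For a further vertex `a`, with
`D = {b ↮ a}` and `Γ = ⋂_{r ∈ R} {c ↔ r}`:
`μ(D ∩ Γ ∩ {b↔o} ∩ {b↮c}) · μ(D ∩ {b↮o} ∩ ⋂_{r∈R}{b↔r}) ≤ μ(D ∩ {b↔o} ∩ ⋂_{r∈R}{b↔r}) · μ(D ∩ Γ ∩ {b↮o} ∩ {b↮c})`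
— the core-attraction determinant survives conditioning on the separation of `b` from `a` (in the o/core
table given `{a ↮ b} ∩ Γ`: rows `o ∈ C_b` / `o ∉ C_b`, columns `R ⊆ C_b` / `b ∉ C_R`).  Proof: van den
Berg–Häggström–Kahn's Thm. 1.3 (conditional positive association of `C_b` given `{b ↮ a}`, tree fact
`BHK2006_clusterConditionalPositiveAssociation_holds`) twice, in place of Harris, with the same decreasing
free-core weight `ρ` and the domain Markov property of `C_b`. [this file] -/
theorem coreAttraction_sep (w : Sym2 V → unitInterval) (o a b c : V) (R : Finset V) :
    (prodBernoulli w).real ((openConn b a : Set (BondConfig V))ᶜ ∩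
        ((⋂ r ∈ R, (openConn c r : Set (BondConfig V))) ∩ openConn b o ∩ (openConn b c)ᶜ)) *
        (prodBernoulli w).real ((openConn b a : Set (BondConfig V))ᶜ ∩
          ((openConn b o : Set (BondConfig V))ᶜ ∩ ⋂ r ∈ R, openConn b r)) ≤
      (prodBernoulli w).real ((openConn b a : Set (BondConfig V))ᶜ ∩
          ((openConn b o : Set (BondConfig V)) ∩ ⋂ r ∈ R, openConn b r)) *
        (prodBernoulli w).real ((openConn b a : Set (BondConfig V))ᶜ ∩
          ((⋂ r ∈ R, (openConn c r : Set (BondConfig V))) ∩ (openConn b o)ᶜ ∩ (openConn b c)ᶜ)) := by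
  classical
  -- degenerate case `a = b`: `{b ↮ b} = ∅`
  by_cases hab : a = b
  · subst hab
    have hc : ((openConn a a : Set (BondConfig V))ᶜ) = ∅ := by
      ext ω
      simp only [Set.mem_compl_iff, Set.mem_empty_iff_false, iff_false, not_not]
      exact SimpleGraph.Reachable.refl a
    simp [hc]
  set w' : Sym2 V → ℝ := fun e => (w e : ℝ) with hw'
  have hw0 : ∀ e, 0 ≤ w' e := fun e => (w e).2.1
  have hw1 : ∀ e, w' e ≤ 1 := fun e => (w e).2.2
  have hm : ∑ ω, weight w' ω = 1 := by
    have h1 := integral_prodBernoulli_eq_sum w fun _ => (1 : ℝ)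
    simp only [integral_const, probReal_univ, smul_eq_mul, mul_one] at h1
    exact h1.symm
  -- events
  set Γ : Set (BondConfig V) := ⋂ r ∈ R, (openConn c r : Set (BondConfig V)) with hΓ
  set Bo : Set (BondConfig V) := openConn b o with hBo
  set HB : Set (BondConfig V) := ⋂ r ∈ R, (openConn b r : Set (BondConfig V)) with hHB
  set D : Set (BondConfig V) := (openConn b c : Set (BondConfig V))ᶜ with hDdef
  have hD : ∀ ω, ω ∈ D ↔ ¬ (openGraph ω).Reachable b c := fun ω => Iff.rfl
  set Da : Set (BondConfig V) := {ω : BondConfig V | ∀ x ∈ ({a} : Set V), ¬ (openGraph ω).Reachable b x}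
    with hDa
  have hDa' : ((openConn b a : Set (BondConfig V))ᶜ) = Da := by
    ext ω; simp only [hDa, Set.mem_setOf_eq, Set.mem_singleton_iff, forall_eq, Set.mem_compl_iff]; rfl
  have hba : b ∉ ({a} : Set V) := fun h => hab (Set.mem_singleton_iff.1 h).symm
  rw [hDa']
  -- functions of the edge cluster `W = C_b`
  let fo : Set (Sym2 V) → ℝ := fun W => if o = b ∨ ∃ e ∈ W, o ∈ e then 1 else 0
  let hR : Set (Sym2 V) → ℝ := fun W => if ∀ r ∈ R, r = b ∨ ∃ e ∈ W, r ∈ e then 1 else 0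
  let G : Set (Sym2 V) → ℝ := fun E => if ∀ r ∈ R, r = c ∨ ∃ e ∈ E, r ∈ e then 1 else 0
  let gc : Set (Sym2 V) → ℝ := fun W => if c = b ∨ ∃ e ∈ W, c ∈ e then 0 else 1
  let Abar : Set (Sym2 V) → Set (Sym2 V) := fun W => {e | ∃ v ∈ e, v = b ∨ ∃ e' ∈ W, v ∈ e'}
  let ρW : Set (Sym2 V) → ℝ := fun W => (∑ η, weight w' η * G (openEdgeCluster (η \ Abar W) c)) * gc W
  have hfo : ∀ ω : Set (Sym2 V), fo (openEdgeCluster ω b) = ind Bo ω := by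
    intro ω
    have : (o = b ∨ ∃ e ∈ openEdgeCluster ω b, o ∈ e) ↔ ω ∈ Bo := by
      rw [← reachable_iff_exists_mem_openEdgeCluster]; rfl
    by_cases h : ω ∈ Bo
    · simp only [fo, if_pos (this.2 h), ind_of_mem h]
    · simp only [fo, if_neg (fun h' => h (this.1 h')), ind_of_not_mem h]
  have hhR : ∀ ω : Set (Sym2 V), hR (openEdgeCluster ω b) = ind HB ω := by
    intro ω
    have : (∀ r ∈ R, r = b ∨ ∃ e ∈ openEdgeCluster ω b, r ∈ e) ↔ ω ∈ HB := by
      simp only [hHB, Set.mem_iInter]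
      refine forall₂_congr fun r _ => ?_
      rw [← reachable_iff_exists_mem_openEdgeCluster]; rfl
    by_cases h : ω ∈ HB
    · simp only [hR, if_pos (this.2 h), ind_of_mem h]
    · simp only [hR, if_neg (fun h' => h (this.1 h')), ind_of_not_mem h]
  have hG : ∀ ω : Set (Sym2 V), G (openEdgeCluster ω c) = ind Γ ω := by
    intro ω
    have : (∀ r ∈ R, r = c ∨ ∃ e ∈ openEdgeCluster ω c, r ∈ e) ↔ ω ∈ Γ := by
      simp only [hΓ, Set.mem_iInter]
      refine forall₂_congr fun r _ => ?_
      rw [← reachable_iff_exists_mem_openEdgeCluster]; rfl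
    by_cases h : ω ∈ Γ
    · simp only [G, if_pos (this.2 h), ind_of_mem h]
    · simp only [G, if_neg (fun h' => h (this.1 h')), ind_of_not_mem h]
  have hgc : ∀ ω : Set (Sym2 V), gc (openEdgeCluster ω b) = ind D ω := by
    intro ω
    have : (c = b ∨ ∃ e ∈ openEdgeCluster ω b, c ∈ e) ↔ (openGraph ω).Reachable b c := by
      rw [← reachable_iff_exists_mem_openEdgeCluster]
    by_cases h : (openGraph ω).Reachable b c
    · have : ω ∉ D := fun h' => (hD ω).1 h' h
      simp only [gc, if_pos ((reachable_iff_exists_mem_openEdgeCluster ω b c).1 h), ind_of_not_mem this]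
    · simp only [gc, if_neg (fun h' => h (this.1 h')), ind_of_mem ((hD ω).2 h)]
  have hG0 : ∀ E, 0 ≤ G E := fun E => by simp only [G]; split_ifs <;> norm_num
  have hG1 : ∀ E, G E ≤ 1 := fun E => by simp only [G]; split_ifs <;> norm_num
  have hGmono : Monotone G := monotone_FO c R
  have hfo_mono : Monotone fo := by
    intro W W' h
    simp only [fo]
    by_cases hW : o = b ∨ ∃ e ∈ W, o ∈ e
    · rw [if_pos hW, if_pos (hW.imp id fun ⟨e, he, hoe⟩ => ⟨e, h he, hoe⟩)]
    · rw [if_neg hW]; split_ifs <;> norm_num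
  have hhR_mono : Monotone hR := monotone_FO b R
  have hgc_anti : Antitone gc := by
    intro W W' h
    simp only [gc]
    by_cases hW : c = b ∨ ∃ e ∈ W, c ∈ e
    · rw [if_pos hW, if_pos (hW.imp id fun ⟨e, he, hce⟩ => ⟨e, h he, hce⟩)]
    · rw [if_neg hW]; split_ifs <;> norm_num
  have hgc0 : ∀ W, 0 ≤ gc W := fun W => by simp only [gc]; split_ifs <;> norm_num
  have hsum0 : ∀ W, 0 ≤ ∑ η, weight w' η * G (openEdgeCluster (η \ Abar W) c) := fun W =>
    Finset.sum_nonneg fun η _ => mul_nonneg (weight_nonneg hw0 hw1 η) (hG0 _)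
  have hρW_anti : Antitone ρW := by
    intro W W' hle
    have h1 : ∑ η, weight w' η * G (openEdgeCluster (η \ Abar W') c) ≤
        ∑ η, weight w' η * G (openEdgeCluster (η \ Abar W) c) := by
      refine Finset.sum_le_sum fun η _ => mul_le_mul_of_nonneg_left ?_ (weight_nonneg hw0 hw1 η)
      refine hGmono (openEdgeCluster_mono (fun e he => ?_) c)
      refine ⟨he.1, fun hA => he.2 ?_⟩
      obtain ⟨v, hv, hvb⟩ := hA
      exact ⟨v, hv, hvb.imp id fun ⟨e', he', hve'⟩ => ⟨e', hle he', hve'⟩⟩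
    exact mul_le_mul h1 (hgc_anti hle) (hgc0 _) (hsum0 _)
  -- BHK Thm. 1.3 for `C_b` given `{b ↮ a}`, as finite sums
  have cpa := BHK2006_clusterConditionalPositiveAssociation_holds V w b ({a} : Set V) fo hR
    hfo_mono hhR_mono hba
  have cpa' := BHK2006_clusterConditionalPositiveAssociation.antitone_right
    BHK2006_clusterConditionalPositiveAssociation_holds V w b ({a} : Set V) fo ρW hfo_mono hρW_anti hba
  rw [← hDa] at cpa cpa'
  simp only [setIntegral_eq_sum_ind] at cpa cpa'
  rw [real_eq_sum_ind] at cpa cpa'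
  -- the domain Markov property of `C_b` (towards `C_c`), with an arbitrary `C_b`-measurable factor
  have markov : ∀ (φ : Set (Sym2 V) → ℝ),
      ∑ ω, weight w' ω * (φ (openEdgeCluster ω b) * G (openEdgeCluster ω c) * ind D ω) =
        ∑ ω, weight w' ω * (φ (openEdgeCluster ω b) * ρW (openEdgeCluster ω b)) := by
    intro φ
    have key := sum_cond_cluster w' hm b c (fun W E => φ W * G E) hD
    rw [key]
    refine Finset.sum_congr rfl fun ω _ => ?_
    congr 1
    have e : ∑ η, weight w' η * (φ (openEdgeCluster ω b) *
        G (openEdgeCluster (η \ {e | ∃ v ∈ e, v = b ∨ ∃ e' ∈ openEdgeCluster ω b, v ∈ e'}) c)) =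
        φ (openEdgeCluster ω b) * ∑ η, weight w' η *
          G (openEdgeCluster (η \ Abar (openEdgeCluster ω b)) c) := by
      simp only [Abar, Finset.mul_sum]
      exact Finset.sum_congr rfl fun η _ => by ring
    rw [e, ← hgc ω]
    simp only [ρW]; ring
  -- the four measures as sums
  have eBF : (prodBernoulli w).real (Da ∩ (Γ ∩ Bo ∩ D)) =
      ∑ ω, weight w' ω * (fo (openEdgeCluster ω b) * ρW (openEdgeCluster ω b) * ind Da ω) := by
    rw [real_eq_sum_ind]
    have h1 := markov (fun W => fo W * ind Da W)  -- placeholder, replaced below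
    clear h1
    have h2 := markov (fun W => fo W * (if a = b ∨ ∃ e ∈ W, a ∈ e then 0 else 1))
    have hga : ∀ ω : Set (Sym2 V), (if a = b ∨ ∃ e ∈ openEdgeCluster ω b, a ∈ e then (0:ℝ) else 1) = ind Da ω := by
      intro ω
      have : (a = b ∨ ∃ e ∈ openEdgeCluster ω b, a ∈ e) ↔ (openGraph ω).Reachable b a := by
        rw [← reachable_iff_exists_mem_openEdgeCluster]
      by_cases h : (openGraph ω).Reachable b a
      · have hn : ω ∉ Da := fun h' =>
          (show ∀ x ∈ ({a} : Set V), ¬ (openGraph ω).Reachable b x from h') a (Set.mem_singleton a) h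
        rw [if_pos (this.2 h), ind_of_not_mem hn]
      · have hy : ω ∈ Da := fun x hx => by
          rw [Set.mem_singleton_iff.1 hx]; exact h
        rw [if_neg (fun h' => h (this.1 h')), ind_of_mem hy]
    simp only [hga] at h2
    have e1 : ∀ ω, fo (openEdgeCluster ω b) * ind Da ω * G (openEdgeCluster ω c) * ind D ω =
        ind (Da ∩ (Γ ∩ Bo ∩ D)) ω := by
      intro ω; rw [hfo, hG, ind_inter, ind_inter, ind_inter]; ring
    have e2 : ∀ ω, fo (openEdgeCluster ω b) * ind Da ω * ρW (openEdgeCluster ω b) =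
        fo (openEdgeCluster ω b) * ρW (openEdgeCluster ω b) * ind Da ω := by intro ω; ring
    simp only [e1, e2] at h2
    exact h2
  have eNF : (prodBernoulli w).real (Da ∩ (Γ ∩ Boᶜ ∩ D)) =
      ∑ ω, weight w' ω * ((1 - fo (openEdgeCluster ω b)) * ρW (openEdgeCluster ω b) * ind Da ω) := by
    rw [real_eq_sum_ind]
    have h2 := markov (fun W => (1 - fo W) * (if a = b ∨ ∃ e ∈ W, a ∈ e then 0 else 1))
    have hga : ∀ ω : Set (Sym2 V), (if a = b ∨ ∃ e ∈ openEdgeCluster ω b, a ∈ e then (0:ℝ) else 1) = ind Da ω := by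
      intro ω
      have : (a = b ∨ ∃ e ∈ openEdgeCluster ω b, a ∈ e) ↔ (openGraph ω).Reachable b a := by
        rw [← reachable_iff_exists_mem_openEdgeCluster]
      by_cases h : (openGraph ω).Reachable b a
      · have hn : ω ∉ Da := fun h' =>
          (show ∀ x ∈ ({a} : Set V), ¬ (openGraph ω).Reachable b x from h') a (Set.mem_singleton a) h
        rw [if_pos (this.2 h), ind_of_not_mem hn]
      · have hy : ω ∈ Da := fun x hx => by
          rw [Set.mem_singleton_iff.1 hx]; exact h
        rw [if_neg (fun h' => h (this.1 h')), ind_of_mem hy]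
    simp only [hga] at h2
    have e1 : ∀ ω, (1 - fo (openEdgeCluster ω b)) * ind Da ω * G (openEdgeCluster ω c) * ind D ω =
        ind (Da ∩ (Γ ∩ Boᶜ ∩ D)) ω := by
      intro ω
      rw [hfo, hG, ind_inter, ind_inter, show Γ ∩ Boᶜ = Boᶜ ∩ Γ from Set.inter_comm _ _,
        CoreAttraction.ind_compl_inter]
      ring
    have e2 : ∀ ω, (1 - fo (openEdgeCluster ω b)) * ind Da ω * ρW (openEdgeCluster ω b) =
        (1 - fo (openEdgeCluster ω b)) * ρW (openEdgeCluster ω b) * ind Da ω := by intro ω; ring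
    simp only [e1, e2] at h2
    exact h2
  have eBB : (prodBernoulli w).real (Da ∩ (Bo ∩ HB)) =
      ∑ ω, weight w' ω * (fo (openEdgeCluster ω b) * hR (openEdgeCluster ω b) * ind Da ω) := by
    rw [real_eq_sum_ind]
    refine Finset.sum_congr rfl fun ω _ => ?_
    rw [hfo, hhR, show Da ∩ (Bo ∩ HB) = (Bo ∩ HB) ∩ Da from Set.inter_comm _ _, ind_inter, ind_inter]
  have eNB : (prodBernoulli w).real (Da ∩ (Boᶜ ∩ HB)) =
      ∑ ω, weight w' ω * ((1 - fo (openEdgeCluster ω b)) * hR (openEdgeCluster ω b) * ind Da ω) := by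
    rw [real_eq_sum_ind]
    refine Finset.sum_congr rfl fun ω _ => ?_
    rw [hfo, hhR, show Da ∩ (Boᶜ ∩ HB) = (Boᶜ ∩ HB) ∩ Da from Set.inter_comm _ _, ind_inter,
      CoreAttraction.ind_compl_inter]
    ring
  -- abbreviations for the sums
  set Sα := ∑ ω, weight w' ω * ind Da ω with hSα
  set SF := ∑ ω, weight w' ω * (fo (openEdgeCluster ω b) * ind Da ω) with hSF
  set SH := ∑ ω, weight w' ω * (hR (openEdgeCluster ω b) * ind Da ω) with hSH
  set Sρ := ∑ ω, weight w' ω * (ρW (openEdgeCluster ω b) * ind Da ω) with hSρ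
  set SFH := ∑ ω, weight w' ω * (fo (openEdgeCluster ω b) * hR (openEdgeCluster ω b) * ind Da ω)
    with hSFH
  set SFρ := ∑ ω, weight w' ω * (fo (openEdgeCluster ω b) * ρW (openEdgeCluster ω b) * ind Da ω)
    with hSFρ
  have lin1 : ∑ ω, weight w' ω * ((1 - fo (openEdgeCluster ω b)) * ρW (openEdgeCluster ω b) * ind Da ω)
      = Sρ - SFρ := by
    rw [hSρ, hSFρ, ← Finset.sum_sub_distrib]
    exact Finset.sum_congr rfl fun ω _ => by ring
  have lin2 : ∑ ω, weight w' ω * ((1 - fo (openEdgeCluster ω b)) * hR (openEdgeCluster ω b) * ind Da ω)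
      = SH - SFH := by
    rw [hSH, hSFH, ← Finset.sum_sub_distrib]
    exact Finset.sum_congr rfl fun ω _ => by ring
  rw [eBF, eNB, eBB, eNF, lin1, lin2]
  -- nonnegativity
  have hfo0 : ∀ W, 0 ≤ fo W := fun W => by simp only [fo]; split_ifs <;> norm_num
  have hfo1 : ∀ W, fo W ≤ 1 := fun W => by simp only [fo]; split_ifs <;> norm_num
  have hhR0 : ∀ W, 0 ≤ hR W := fun W => by simp only [hR]; split_ifs <;> norm_num
  have hρW0 : ∀ W, 0 ≤ ρW W := fun W => mul_nonneg (hsum0 W) (hgc0 W)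
  have hSH0 : 0 ≤ SH := Finset.sum_nonneg fun ω _ =>
    mul_nonneg (weight_nonneg hw0 hw1 ω) (mul_nonneg (hhR0 _) (ind_nonneg _ _))
  have hSρ0 : 0 ≤ Sρ := Finset.sum_nonneg fun ω _ =>
    mul_nonneg (weight_nonneg hw0 hw1 ω) (mul_nonneg (hρW0 _) (ind_nonneg _ _))
  have hSFρ0 : 0 ≤ SFρ := Finset.sum_nonneg fun ω _ =>
    mul_nonneg (weight_nonneg hw0 hw1 ω) (mul_nonneg (mul_nonneg (hfo0 _) (hρW0 _)) (ind_nonneg _ _))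
  have hSFH0 : 0 ≤ SFH := Finset.sum_nonneg fun ω _ =>
    mul_nonneg (weight_nonneg hw0 hw1 ω) (mul_nonneg (mul_nonneg (hfo0 _) (hhR0 _)) (ind_nonneg _ _))
  have hSα0 : 0 ≤ Sα := Finset.sum_nonneg fun ω _ => mul_nonneg (weight_nonneg hw0 hw1 ω) (ind_nonneg _ _)
  have hSFρ_le : SFρ ≤ Sα := by
    refine Finset.sum_le_sum fun ω _ => mul_le_mul_of_nonneg_left ?_ (weight_nonneg hw0 hw1 ω)
    have hρ1 : ρW (openEdgeCluster ω b) ≤ 1 := by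
      have hs1 : ∑ η, weight w' η * G (openEdgeCluster (η \ Abar (openEdgeCluster ω b)) c) ≤ 1 := by
        calc ∑ η, weight w' η * G (openEdgeCluster (η \ Abar (openEdgeCluster ω b)) c)
            ≤ ∑ η, weight w' η * 1 := Finset.sum_le_sum fun η _ =>
              mul_le_mul_of_nonneg_left (hG1 _) (weight_nonneg hw0 hw1 η)
          _ = 1 := by simp [hm]
      have hgc1 : gc (openEdgeCluster ω b) ≤ 1 := by simp only [gc]; split_ifs <;> norm_num
      exact (mul_le_mul hs1 hgc1 (hgc0 _) zero_le_one).trans (by norm_num)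
    calc fo (openEdgeCluster ω b) * ρW (openEdgeCluster ω b) * ind Da ω
        ≤ 1 * 1 * ind Da ω := by
          refine mul_le_mul_of_nonneg_right (mul_le_mul (hfo1 _) hρ1 (hρW0 _) zero_le_one) (ind_nonneg _ _)
      _ = ind Da ω := by ring
  have hSFH_le : SFH ≤ Sα := by
    refine Finset.sum_le_sum fun ω _ => mul_le_mul_of_nonneg_left ?_ (weight_nonneg hw0 hw1 ω)
    have hhR1 : hR (openEdgeCluster ω b) ≤ 1 := by simp only [hR]; split_ifs <;> norm_num
    calc fo (openEdgeCluster ω b) * hR (openEdgeCluster ω b) * ind Da ω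
        ≤ 1 * 1 * ind Da ω := by
          refine mul_le_mul_of_nonneg_right (mul_le_mul (hfo1 _) hhR1 (hhR0 _) zero_le_one) (ind_nonneg _ _)
      _ = ind Da ω := by ring
  -- `cpa : SF * SH ≤ Sα * SFH`, `cpa' : Sα * SFρ ≤ SF * Sρ`
  have c1 : SF * SH ≤ Sα * SFH := cpa
  have c2 : Sα * SFρ ≤ SF * Sρ := cpa'
  -- conclude
  by_cases hα : Sα = 0
  · have h1 : SFρ = 0 := le_antisymm (hα ▸ hSFρ_le) hSFρ0
    have h2 : SFH = 0 := le_antisymm (hα ▸ hSFH_le) hSFH0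
    rw [h1, h2]; simp
  · have hαpos : 0 < Sα := lt_of_le_of_ne hSα0 (Ne.symm hα)
    have key : Sα * (SH * SFρ) ≤ Sα * (SFH * Sρ) := by nlinarith [c1, c2, hSρ0, hSH0]
    have key' : SH * SFρ ≤ SFH * Sρ := le_of_mul_le_mul_left key hαpos
    nlinarith [key', hSFρ0, hSFH0]

/-- **Core attraction given `{a ↮ b}`, in the orientation of the odds-shift assembly** (`{a ↮ b}`, `{o ↔ b}` written
with `openConn a b`, `openConn o b`; same inequality as `coreAttraction_sep`, events rewritten by the symmetry of `↔`).
This is the form consumed next to `CoreRepulsionSep.coreRepulsion_sep` when the two rows are chained into the one-sided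
odds shift (T3) of `…CoreExchangeOddsShift.lean`. [this file] -/
theorem coreAttraction_sep' (w : Sym2 V → unitInterval) (o a b c : V) (R : Finset V) :
    (prodBernoulli w).real ((openConn a b : Set (BondConfig V))ᶜ ∩
        ((⋂ r ∈ R, (openConn c r : Set (BondConfig V))) ∩ openConn o b ∩ (openConn b c)ᶜ)) *
        (prodBernoulli w).real ((openConn a b : Set (BondConfig V))ᶜ ∩
          ((openConn o b : Set (BondConfig V))ᶜ ∩ ⋂ r ∈ R, openConn b r)) ≤
      (prodBernoulli w).real ((openConn a b : Set (BondConfig V))ᶜ ∩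
          ((openConn o b : Set (BondConfig V)) ∩ ⋂ r ∈ R, openConn b r)) *
        (prodBernoulli w).real ((openConn a b : Set (BondConfig V))ᶜ ∩
          ((⋂ r ∈ R, (openConn c r : Set (BondConfig V))) ∩ (openConn o b)ᶜ ∩ (openConn b c)ᶜ)) := by
  have hba : (openConn b a : Set (BondConfig V)) = openConn a b :=
    Set.ext fun ω => ⟨fun h => SimpleGraph.Reachable.symm h, fun h => SimpleGraph.Reachable.symm h⟩
  have hbo : (openConn b o : Set (BondConfig V)) = openConn o b :=
    Set.ext fun ω => ⟨fun h => SimpleGraph.Reachable.symm h, fun h => SimpleGraph.Reachable.symm h⟩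
  have h := coreAttraction_sep w o a b c R
  rw [hba, hbo] at h
  exact h

end CoreAttractionSep

end Summit.CriticalPhenomena.PercolationContinuityZ3.Theorems

end
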